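import Summits.CriticalPhenomena.PercolationContinuityZ3.Theorems.PercNearOneGluingNoHeavyRsw3InvasionBackbone
import Mathlib.Data.Nat.Nth
import HarnessLib

/-!
# RSW3 lane (P2, gen 29): INVASION PERCOLATION XXXVI — THE BACKBONE EXISTS: the invasion tree has EXACTLY ONE self-avoiding ray from the root
# (every infinite connected locally finite graph with outlets beyond every time; a.s. on `ℤ^d`, `d ≥ 2`, by p205010)

builds on p205010 (kernel theorem, internal audit signed; external expert review pending) — used only in the `ℤ^d` statements (through file XXX).

Cell `prim-rsw3`, prover seat `prim-rsw3-p2` (gen 29), memo `run/shared/lean/prim/rsw3/P2-RSWLITE.md` §36.  Support file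
(`--supports stmt-CriticalPhenomena-4575`); no definitions, no named facts, no sorries.

Construction of the backbone (König's lemma made explicit by the outlets).  For an outlet step `m` with absorbed dart `a`, every tree walk from the root to a
vertex invaded after `m` traverses the outlet bond (cut-edge theorem, file XXIX), so the unique tree PATH from the root to the far endpoint of a LATER outlet
extends the unique tree path to `a.2` (`path_prefix_of_outlets`: acyclicity, file XXXIII, + Mathlib `IsAcyclic.path_unique`).  Along the infinite increasing
sequence of outlets (`Nat.nth`) these paths are nested with strictly increasing lengths; reading off the `i`-th vertex of the `i`-th path gives a self-avoiding
ray from the root (`exists_ray`).  With `ray_unique` (file XXXV): **exactly one ray** (`existsUnique_ray`), i.e. the invasion tree has one end in the strongest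
sense; on `ℤ^d` (`d ≥ 2`) almost surely (`ae_existsUnique_ray`, `ae_existsUnique_ray_Z3`).

References: R. Lyons, Y. Peres, O. Schramm, Ann. Probab. 34 (2006), Thm. 3.12 (proof) [LyonsPeresSchramm2006]; M. Damron, A. Sapozhnikov, PTRF (2010) §1.3 (backbone).
-/

noncomputable section

namespace Summit.CriticalPhenomena.PercolationContinuityZ3.Theorems.Rsw3

open Finset Filter MeasureTheory Literature.Probability.LatticeModels Literature.Probability.Percolation Literature.Probability.Percolation.Invasion

section General

variable {V : Type*} [DecidableEq V] {G : SimpleGraph V} [G.LocallyFinite]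

/-- **Every tree walk from the root to a vertex not in `I_m` traverses the outlet bond** (`m` an outlet with absorbed dart `a`): the outlet bond is a cut-edge
whose root side is `I_m` (file XXIX). [cite: LyonsPeresSchramm2006, Thm. 3.12 (proof: e_k separates o from infinity)] -/
theorem outlet_mem_edges_of_walk {U : Sym2 V → ℝ} {o : V} {m : ℕ} (hm : IsOutlet G U o m) {a : V × V}
    (ha : newDart G U (invasion G U o m) = some a) {v : V} (hv : v ∉ invasion G U o m) (p : (tree G U o).Walk o v) :
    s(a.1, a.2) ∈ p.edges := by
  by_contra h
  exact not_reachable_deleteEdges_outlet hm ha hv (SimpleGraph.reachable_deleteEdges_iff_exists_walk.2 ⟨p, h⟩)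

/-- **Nested root paths.**  For outlet steps `m < m'` with absorbed darts `a`, `a'` and tree paths `P : o ⇝ a.2`, `P' : o ⇝ a'.2` (self-avoiding), `P` is a proper
prefix of `P'`: `P.length < P'.length` and `P.getVert t = P'.getVert t` for `t ≤ P.length`. [cite: LyonsPeresSchramm2006, Thm. 3.12 (proof)] -/
theorem path_prefix_of_outlets {U : Sym2 V → ℝ} {o : V} {m m' : ℕ} (hm : IsOutlet G U o m) (hmm' : m < m') {a a' : V × V}
    (ha : newDart G U (invasion G U o m) = some a) (ha' : newDart G U (invasion G U o m') = some a')
    (P : (tree G U o).Walk o a.2) (hP : P.IsPath) (P' : (tree G U o).Walk o a'.2) (hP' : P'.IsPath) :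
    P.length < P'.length ∧ ∀ t, t ≤ P.length → P.getVert t = P'.getVert t := by
  -- `a'.2 ∉ I_m`, so `P'` crosses the outlet bond of `m`, hence visits `a.2`
  have ha'2 : a'.2 ∉ invasion G U o m := fun h => snd_not_mem_of_newDart ha' (invasion_mono U o hmm'.le h)
  have hmem : a.2 ∈ P'.support := P'.snd_mem_support_of_mem_edges (outlet_mem_edges_of_walk hm ha ha'2 P')
  -- the initial segment of `P'` up to `a.2` is THE path from `o` to `a.2`
  have hQ : P'.takeUntil a.2 hmem = P := by
    have := (tree_isAcyclic U o).path_unique ⟨P'.takeUntil a.2 hmem, hP'.takeUntil hmem⟩ ⟨P, hP⟩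
    exact congrArg Subtype.val this
  have hne : a.2 ≠ a'.2 := by
    intro h
    have h2 : a.2 ∈ invasion G U o m' := invasion_mono U o (Nat.succ_le_of_lt hmm') (snd_mem_invasion_of_lt (Nat.lt_succ_self m) ha)
    rw [h] at h2
    exact snd_not_mem_of_newDart ha' h2
  refine ⟨?_, fun t ht => ?_⟩
  · have := P'.length_takeUntil_lt_length hmem hne
    rwa [hQ] at this
  · have := SimpleGraph.Walk.getVert_takeUntil hmem (n := t) (by rw [hQ]; exact ht)
    rwa [hQ] at this

/-- **THE BACKBONE EXISTS**: on an infinite connected locally finite graph whose invasion from `o` has outlets beyond every time, the invasion tree contains a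
self-avoiding ray `o = r 0 ~ r 1 ~ ⋯` (read off the nested root paths to the far endpoints of the successive outlets).
[cite: LyonsPeresSchramm2006, Thm. 3.12 (proof)] -/
theorem exists_ray [Infinite V] (hG : G.Preconnected) {U : Sym2 V → ℝ} {o : V} (hout : ∀ k, ∃ m, k ≤ m ∧ IsOutlet G U o m) :
    ∃ r : ℕ → V, Function.Injective r ∧ r 0 = o ∧ ∀ i, (tree G U o).Adj (r i) (r (i + 1)) := by
  classical
  -- the outlet steps in increasing order
  have hinf : {m | IsOutlet G U o m}.Infinite := by
    refine Set.infinite_of_forall_exists_gt fun k => ?_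
    obtain ⟨m, hkm, hm⟩ := hout (k + 1)
    exact ⟨m, hm, Nat.lt_of_succ_le hkm⟩
  have hfout : ∀ k, IsOutlet G U o (Nat.nth (fun m => IsOutlet G U o m) k) := fun k => Nat.nth_mem_of_infinite hinf k
  have hfmono : StrictMono (Nat.nth fun m => IsOutlet G U o m) := Nat.nth_strictMono hinf
  -- their darts and the root paths to the far endpoints
  have hdart : ∀ k, ∃ a : V × V, newDart G U (invasion G U o (Nat.nth (fun m => IsOutlet G U o m) k)) = some a := fun k =>
    exists_newDart_eq_some (U := U) (boundaryDarts_invasion_nonempty hG U o _)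
  choose a ha using hdart
  have hpath : ∀ k, ∃ P : (tree G U o).Walk o (a k).2, P.IsPath := fun k => by
    obtain ⟨q⟩ := tree_reachable_of_mem_invasion (snd_mem_invasion_of_lt (Nat.lt_succ_self _) (ha k))
    exact ⟨q.toPath.1, q.toPath.2⟩
  choose P hP using hpath
  -- nesting
  have hnest : ∀ k k', k < k' → (P k).length < (P k').length ∧ ∀ t, t ≤ (P k).length → (P k).getVert t = (P k').getVert t :=
    fun k k' hkk' => path_prefix_of_outlets (hfout k) (hfmono hkk') (ha k) (ha k') (P k) (hP k) (P k') (hP k')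
  have hlen : ∀ k, k ≤ (P k).length := by
    intro k
    induction k with
    | zero => exact Nat.zero_le _
    | succ k ih => exact Nat.succ_le_of_lt (lt_of_le_of_lt ih (hnest k (k + 1) (Nat.lt_succ_self k)).1)
  -- consistency of the readings
  have hcons : ∀ i k, i ≤ k → (P i).getVert i = (P k).getVert i := by
    intro i k hik
    rcases hik.lt_or_eq with hlt | rfl
    · exact (hnest i k hlt).2 i (hlen i)
    · rfl
  refine ⟨fun i => (P i).getVert i, fun i j hij => ?_, (P 0).getVert_zero, fun i => ?_⟩
  · -- injectivity: read both off `P (max i j)`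
    simp only at hij
    rw [hcons i (max i j) (le_max_left _ _), hcons j (max i j) (le_max_right _ _)] at hij
    exact (hP (max i j)).getVert_injOn (by simp only [Set.mem_setOf_eq]; exact (le_max_left i j).trans (hlen _))
      (by simp only [Set.mem_setOf_eq]; exact (le_max_right i j).trans (hlen _)) hij
  · -- adjacency: read both off `P (i+1)`
    show (tree G U o).Adj ((P i).getVert i) ((P (i + 1)).getVert (i + 1))
    rw [hcons i (i + 1) (Nat.le_succ i)]
    exact (P (i + 1)).adj_getVert_succ (Nat.lt_of_succ_le (hlen (i + 1)))

/-- **THE INVASION TREE HAS EXACTLY ONE RAY FROM THE ROOT** (every infinite connected locally finite graph with outlets beyond every time): existence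
(`exists_ray`) and uniqueness (`ray_unique`, file XXXV). [cite: LyonsPeresSchramm2006, Thm. 3.12 (proof: "the invasion tree of o has a.s. one end")] -/
theorem existsUnique_ray [Infinite V] (hG : G.Preconnected) {U : Sym2 V → ℝ} {o : V} (hout : ∀ k, ∃ m, k ≤ m ∧ IsOutlet G U o m) :
    ∃! r : ℕ → V, Function.Injective r ∧ r 0 = o ∧ ∀ i, (tree G U o).Adj (r i) (r (i + 1)) := by
  obtain ⟨r, hr, h0, hadj⟩ := exists_ray hG hout
  exact ⟨r, ⟨hr, h0, hadj⟩, fun r' hr' => (ray_unique hG hout hr hr'.1 h0 hr'.2.1 hadj hr'.2.2).symm⟩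

end General

/-! ## `ℤ^d` -/

variable {d : ℕ}

/-- **A.S. THE INVASION TREE OF `ℤ^d` HAS EXACTLY ONE RAY FROM THE ORIGIN** (`d ≥ 2`, via p205010): there is one and only one self-avoiding path
`0 = r 0 ~ r 1 ~ ⋯` to infinity in `Invasion.tree (zdGraph d) U 0` — the backbone; it crosses every outlet (file XXX).  Lyons–Peres–Schramm 2006 Thm 3.12 ¶1 /
Alexander 1995 (conditional on `θ(p_c) = 0`) in its sharpest form, unconditionally for every `d ≥ 2`. [cite: LyonsPeresSchramm2006, Thm. 1.1 / Thm. 3.12 (proof)] -/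
theorem ae_existsUnique_ray (hd : 2 ≤ d) :
    ∀ᵐ U ∂(labelMeasure (Site d)), ∃! r : ℕ → Site d, Function.Injective r ∧ r 0 = 0 ∧ ∀ i, (tree (zdGraph d) U 0).Adj (r i) (r (i + 1)) := by
  haveI : Nonempty (Fin d) := ⟨⟨0, by omega⟩⟩
  haveI : Infinite (Site d) := Pi.infinite_of_right
  filter_upwards [ae_forall_exists_isOutlet hd] with U hU
  exact existsUnique_ray zdGraph_preconnected_holds fun k => (hU k).imp fun m hm => ⟨hm.1, hm.2.1⟩

/-- **`ℤ³`: almost surely the invasion tree has exactly one ray from the origin.** [cite: LyonsPeresSchramm2006, Thm. 1.1 / Thm. 3.12 (proof)] -/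
theorem ae_existsUnique_ray_Z3 :
    ∀ᵐ U ∂(labelMeasure (Site 3)), ∃! r : ℕ → Site 3, Function.Injective r ∧ r 0 = 0 ∧ ∀ i, (tree (zdGraph 3) U 0).Adj (r i) (r (i + 1)) :=
  ae_existsUnique_ray (by norm_num)

end Summit.CriticalPhenomena.PercolationContinuityZ3.Theorems.Rsw3
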